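import Summits.NavierStokesRegularity.NavierStokesRegularity.Theorems.FilamentSkeletonRssCoreLinearInvertibilityOddAttenuationRotation
import Summits.AnomalousDissipation.AnomalousDissipation.Theorems.MarginalStabilityChainStretchedVortexRowsStubCircAvgPolar
import Summits.AnomalousDissipation.AnomalousDissipation.Theorems.MarginalStabilityChainStretchedVortexRowsStubCellSolvabilityRadialWeights
import Literature.Analysis.FluidPDE.PlanarPolarCoords

/-!
# Tools G for stub `stub_oddAttenuation` of crux `CoreLinearInvertibility`
# (stmt-NavierStokesRegularity-17973), line `Sketch`: circle-wise Wirtinger for odd functions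

The only place where ODDNESS enters the attenuation estimate: an odd `C¹` function restricted to a
circle `θ ↦ u(r cos θ, r sin θ)` is antiperiodic under `θ ↦ θ + π`, hence has ZERO MEAN over a
period, so the sharp periodic Wirtinger inequality (landed `wirtinger_periodic`, period `2π`)
gives `∮ u² ≤ ∮ (∂_θu)²` on every circle (`(u ∘ γ_r)′ = Du[γ_r^⊥] = ∂_θu`). Integrating against
the radial angular velocity `Ω = (8π)⁻¹φ(|x|²/4)` (comparison principle, circle by circle):
`∫ Ω u² ≤ ∫ Ω (∂_θu)² = Θ`. With the lower bound `Ω ≥ (2π(4+|x|²))⁻¹` (the tree's `inv_one_add_le_burgersPhi`)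
and the pointwise split `1 ≤ 2π(4+ρ²)Ω + |x|²/ρ²` this yields, for every `ρ > 0`,
`∫ u² ≤ 2π(4+ρ²) Θ + ρ⁻² ∫|x|²u²`.
-/

set_option linter.dupNamespace false

noncomputable section

namespace Summit.NavierStokesRegularity.NavierStokesRegularity.Theorems

open MeasureTheory Filter Topology Set
open Literature.Analysis.FluidPDE
open Summit.AnomalousDissipation.AnomalousDissipation.Theorems.MarginalStabilityChainStretchedVortexRows
open scoped InnerProductSpace Laplacian ContDiff

/-! ### The angular velocity is bounded below by `(2π(4+|x|²))⁻¹` -/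

/-- **`Ω ≥ (2π(4+|x|²))⁻¹`** for the angular velocity `Ω = (8π)⁻¹ φ(|x|²/4)` of the Gaussian vortex. [folklore] -/
theorem inv_le_omega (x : EuclideanSpace ℝ (Fin 2)) :
    (2 * Real.pi * (4 + ‖x‖ ^ 2))⁻¹ ≤ (8 * Real.pi)⁻¹ * burgersPhi (‖x‖ ^ 2 / 4) := by
  have h := inv_one_add_le_burgersPhi (s := ‖x‖ ^ 2 / 4) (by positivity)
  have hπ := Real.pi_pos
  calc (2 * Real.pi * (4 + ‖x‖ ^ 2))⁻¹ = (8 * Real.pi)⁻¹ * (1 + ‖x‖ ^ 2 / 4)⁻¹ := by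
        rw [← mul_inv]; congr 1; ring
    _ ≤ (8 * Real.pi)⁻¹ * burgersPhi (‖x‖ ^ 2 / 4) := mul_le_mul_of_nonneg_left h (by positivity)

/-- The pointwise two-zone split `u² ≤ 2π(4+ρ²) Ω u² + ρ⁻²|x|² u²` (`|x| ≤ ρ`: use `Ω ≥ (2π(4+ρ²))⁻¹`;
`|x| > ρ`: use `|x|²/ρ² ≥ 1`). [folklore] -/
theorem sq_le_two_zone_split (u : EuclideanSpace ℝ (Fin 2) → ℝ) {ρ : ℝ} (hρ : 0 < ρ) (x : EuclideanSpace ℝ (Fin 2)) :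
    u x ^ 2 ≤ 2 * Real.pi * (4 + ρ ^ 2) * ((8 * Real.pi)⁻¹ * burgersPhi (‖x‖ ^ 2 / 4) * u x ^ 2) +
      (ρ ^ 2)⁻¹ * (‖x‖ ^ 2 * u x ^ 2) := by
  have hΩ := inv_le_omega x
  have hπ := Real.pi_pos
  have hΩ0 : 0 < (8 * Real.pi)⁻¹ * burgersPhi (‖x‖ ^ 2 / 4) := mul_pos (by positivity) (burgersPhi_pos _)
  have hu2 := sq_nonneg (u x)
  have hkey : 1 ≤ 2 * Real.pi * (4 + ρ ^ 2) * ((8 * Real.pi)⁻¹ * burgersPhi (‖x‖ ^ 2 / 4)) +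
      (ρ ^ 2)⁻¹ * ‖x‖ ^ 2 := by
    by_cases hx : ‖x‖ ^ 2 ≤ ρ ^ 2
    · have h1 : 1 ≤ 2 * Real.pi * (4 + ρ ^ 2) * (2 * Real.pi * (4 + ‖x‖ ^ 2))⁻¹ := by
        rw [← div_eq_mul_inv, le_div_iff₀ (by positivity)]
        nlinarith
      have h2 : 2 * Real.pi * (4 + ρ ^ 2) * (2 * Real.pi * (4 + ‖x‖ ^ 2))⁻¹ ≤
          2 * Real.pi * (4 + ρ ^ 2) * ((8 * Real.pi)⁻¹ * burgersPhi (‖x‖ ^ 2 / 4)) :=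
        mul_le_mul_of_nonneg_left hΩ (by positivity)
      have h3 : 0 ≤ (ρ ^ 2)⁻¹ * ‖x‖ ^ 2 := by positivity
      linarith
    · rw [not_le] at hx
      have h1 : 1 ≤ (ρ ^ 2)⁻¹ * ‖x‖ ^ 2 := by
        rw [← div_eq_inv_mul, le_div_iff₀ (by positivity)]; linarith
      have h3 : 0 ≤ 2 * Real.pi * (4 + ρ ^ 2) * ((8 * Real.pi)⁻¹ * burgersPhi (‖x‖ ^ 2 / 4)) := by positivity
      linarith
  nlinarith [mul_le_mul_of_nonneg_right hkey hu2]

/-! ### Wirtinger on circles for odd functions -/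

/-- **Circle-wise Wirtinger for odd functions**: for `u ∈ C¹(ℝ²)` odd and every `r`,
`∫_{−π}^{π} u(γ_r)² ≤ ∫_{−π}^{π} (Du(γ_r)[γ_r^⊥])²`, `γ_r(θ) = (r cos θ, r sin θ)` — `u ∘ γ_r` is
`2π`-periodic with zero mean (antiperiodic under `θ ↦ θ + π`), so `wirtinger_periodic` applies with
period `2π`, and `(u ∘ γ_r)′ = Du[γ_r^⊥]`. [folklore] -/
theorem intervalIntegral_sq_circle_le_of_odd (u : EuclideanSpace ℝ (Fin 2) → ℝ) (hu : ContDiff ℝ 1 u)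
    (hodd : ∀ x, u (-x) = -u x) (r : ℝ) :
    ∫ θ in (-Real.pi)..Real.pi, u (circlePt r θ) ^ 2 ≤
      ∫ θ in (-Real.pi)..Real.pi, (fderiv ℝ u (circlePt r θ) (perp (circlePt r θ))) ^ 2 := by
  set g : ℝ → ℝ := fun θ => u (circlePt r θ) with hg
  have hγ : ContDiff ℝ 1 (fun θ : ℝ => circlePt r θ) := by
    rw [show (fun θ : ℝ => circlePt r θ) = fun θ => (r * Real.cos θ) • EuclideanSpace.single (0 : Fin 2) (1 : ℝ) +
        (r * Real.sin θ) • EuclideanSpace.single (1 : Fin 2) (1 : ℝ) from funext (circlePt_eq_smul_single r)]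
    fun_prop
  have hgC : ContDiff ℝ 1 g := hu.comp hγ
  have hgd : ∀ θ, HasDerivAt g (fderiv ℝ u (circlePt r θ) (perp (circlePt r θ))) θ := fun θ =>
    ((hu.differentiable one_ne_zero) _).hasFDerivAt.comp_hasDerivAt θ (hasDerivAt_circlePt r θ)
  have hderiv : ∀ θ, deriv g θ = fderiv ℝ u (circlePt r θ) (perp (circlePt r θ)) := fun θ => (hgd θ).deriv
  -- antiperiodicity from oddness
  have hneg : ∀ θ, circlePt (-r) θ = -circlePt r θ := fun θ => by
    ext i; fin_cases i <;> simp [circlePt]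
  have hanti : ∀ θ, g (θ + Real.pi) = -g θ := by
    intro θ
    simp only [hg, circlePt_add_pi, hneg, hodd]
  have hper : g (-Real.pi) = g Real.pi := by
    have h1 := hanti (-Real.pi)
    rw [neg_add_cancel] at h1
    have h2 := hanti 0
    rw [zero_add] at h2
    linarith
  have hgc : Continuous g := hgC.continuous
  have hmean : ∫ θ in (-Real.pi)..Real.pi, g θ = 0 := by
    have hii : ∀ a b, IntervalIntegrable g volume a b := fun a b => hgc.intervalIntegrable _ _
    rw [← intervalIntegral.integral_add_adjacent_intervals (hii (-Real.pi) 0) (hii 0 Real.pi)]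
    have hshift : ∫ θ in (0 : ℝ)..Real.pi, g θ = -∫ θ in (-Real.pi)..0, g θ := by
      have h := intervalIntegral.integral_comp_add_right g Real.pi (a := -Real.pi) (b := 0)
      rw [neg_add_cancel, zero_add] at h
      rw [← h, ← intervalIntegral.integral_neg]
      exact intervalIntegral.integral_congr fun θ _ => hanti θ
    linarith
  have hW := wirtinger_periodic hgC (by linarith [Real.pi_pos] : -Real.pi < Real.pi) hper hmean
  have e : ((Real.pi - -Real.pi) / (2 * Real.pi)) ^ 2 = 1 := by
    field_simp; ring
  rw [e, one_mul] at hW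
  simp_rw [hderiv] at hW
  exact hW

/-- **`∫ Ω u² ≤ ∫ Ω (∂_θu)²`** for `u ∈ C¹(ℝ²)` odd with `Ω(∂_θu)² ∈ L¹` (`Ω = (8π)⁻¹φ(|x|²/4)` is radial,
continuous and positive: comparison circle by circle, in polar coordinates); in particular `Ω u² ∈ L¹`. [folklore] -/
theorem integral_omega_mul_sq_le (u : EuclideanSpace ℝ (Fin 2) → ℝ) (hu : ContDiff ℝ 1 u)
    (hodd : ∀ x, u (-x) = -u x)
    (hint : Integrable fun x => (8 * Real.pi)⁻¹ * burgersPhi (‖x‖ ^ 2 / 4) * fderiv ℝ u x (perp x) ^ 2) :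
    Integrable (fun x => (8 * Real.pi)⁻¹ * burgersPhi (‖x‖ ^ 2 / 4) * u x ^ 2) ∧
      ∫ x, (8 * Real.pi)⁻¹ * burgersPhi (‖x‖ ^ 2 / 4) * u x ^ 2 ≤
        ∫ x, (8 * Real.pi)⁻¹ * burgersPhi (‖x‖ ^ 2 / 4) * fderiv ℝ u x (perp x) ^ 2 := by
  have hΩc : Continuous fun x : EuclideanSpace ℝ (Fin 2) => (8 * Real.pi)⁻¹ * burgersPhi (‖x‖ ^ 2 / 4) :=
    (contDiff_omega (n := 0)).continuous
  have hΩ0 : ∀ x : EuclideanSpace ℝ (Fin 2), 0 ≤ (8 * Real.pi)⁻¹ * burgersPhi (‖x‖ ^ 2 / 4) := fun x =>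
    (mul_pos (by positivity) (burgersPhi_pos _)).le
  have hθc : Continuous fun x => fderiv ℝ u x (perp x) := (hu.continuous_fderiv one_ne_zero).clm_apply continuous_perp
  refine integral_le_integral_of_forall_circle (hΩc.mul (hu.continuous.pow 2)) (hΩc.mul (hθc.pow 2))
    (fun x => mul_nonneg (hΩ0 x) (sq_nonneg _)) (fun x => mul_nonneg (hΩ0 x) (sq_nonneg _)) hint fun r hr => ?_
  have hΩr : ∀ θ, (8 * Real.pi)⁻¹ * burgersPhi (‖circlePt r θ‖ ^ 2 / 4) = (8 * Real.pi)⁻¹ * burgersPhi (r ^ 2 / 4) := by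
    intro θ; rw [norm_circlePt, sq_abs]
  show ∫ θ in (-Real.pi)..Real.pi, (8 * Real.pi)⁻¹ * burgersPhi (‖circlePt r θ‖ ^ 2 / 4) * u (circlePt r θ) ^ 2 ≤
    ∫ θ in (-Real.pi)..Real.pi, (8 * Real.pi)⁻¹ * burgersPhi (‖circlePt r θ‖ ^ 2 / 4) *
      fderiv ℝ u (circlePt r θ) (perp (circlePt r θ)) ^ 2
  simp_rw [hΩr]
  rw [intervalIntegral.integral_const_mul, intervalIntegral.integral_const_mul]
  exact mul_le_mul_of_nonneg_left (intervalIntegral_sq_circle_le_of_odd u hu hodd r)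
    (mul_pos (by positivity) (burgersPhi_pos _)).le

/-! ### The two-zone lower bound for `Θ = ∫ Ω (∂_θu)²` -/

section Decay

variable {u : EuclideanSpace ℝ (Fin 2) → ℝ} (hu : ContDiff ℝ 2 u)
  (hB : ∃ (C : ℝ) (N : ℕ), ∀ x, |u x| ≤ C * (1 + ‖x‖) ^ N * Real.exp (-(1 / 8 * ‖x‖ ^ 2)) ∧
      ‖fderiv ℝ u x‖ ≤ C * (1 + ‖x‖) ^ N * Real.exp (-(1 / 8 * ‖x‖ ^ 2)) ∧
      ‖fderiv ℝ (fderiv ℝ u) x‖ ≤ C * (1 + ‖x‖) ^ N * Real.exp (-(1 / 8 * ‖x‖ ^ 2)))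

include hu hB in
/-- **(Θ) The two-zone lower bound**: for `u ∈ C²` odd of Gaussian decay and every `ρ > 0`,
`∫ u² ≤ 2π(4+ρ²) ∫ Ω (∂_θu)² + ρ⁻² ∫|x|²u²`. [folklore] -/
theorem oddAttenuation_twoZone_estimate (hodd : ∀ x, u (-x) = -u x) {ρ : ℝ} (hρ : 0 < ρ) :
    ∫ x, u x ^ 2 ≤ 2 * Real.pi * (4 + ρ ^ 2) *
        (∫ x, (8 * Real.pi)⁻¹ * burgersPhi (‖x‖ ^ 2 / 4) * fderiv ℝ u x (perp x) ^ 2) +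
      (ρ ^ 2)⁻¹ * ∫ x, ‖x‖ ^ 2 * u x ^ 2 := by
  have hU := gaussDecay_self hB
  have hUθ := gaussDecay_fderiv_perp hB
  have hcθ := continuous_fderiv_perp_of_contDiff_two hu
  have iΘ : Integrable fun x => (8 * Real.pi)⁻¹ * burgersPhi (‖x‖ ^ 2 / 4) * fderiv ℝ u x (perp x) ^ 2 :=
    integrable_of_gaussDecay (by norm_num) ((contDiff_omega (n := 0)).continuous.mul (hcθ.pow 2))
      (gaussDecay_of_le_poly_mul_mul polyBound_omega hUθ hUθ fun x => abs_mul_sq_le _ _)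
  obtain ⟨iΩ, hWirt⟩ := integral_omega_mul_sq_le u (hu.of_le one_le_two) hodd iΘ
  have iu2 : Integrable fun x => u x ^ 2 :=
    integrable_of_gaussDecay (by norm_num) (hu.continuous.pow 2)
      (gaussDecay_of_le_poly_mul_mul (polyBound_const 1) hU hU fun x => abs_sq_le_one_mul _)
  have iX : Integrable fun x => ‖x‖ ^ 2 * u x ^ 2 :=
    integrable_of_gaussDecay (by norm_num) ((continuous_norm.pow 2).mul (hu.continuous.pow 2))
      (gaussDecay_of_le_poly_mul_mul polyBound_norm_sq hU hU fun x => abs_mul_sq_le _ _)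
  have i1 : Integrable fun x => 2 * Real.pi * (4 + ρ ^ 2) * ((8 * Real.pi)⁻¹ * burgersPhi (‖x‖ ^ 2 / 4) * u x ^ 2) :=
    iΩ.const_mul _
  have i2 : Integrable fun x => (ρ ^ 2)⁻¹ * (‖x‖ ^ 2 * u x ^ 2) := iX.const_mul _
  calc ∫ x, u x ^ 2 ≤ ∫ x, 2 * Real.pi * (4 + ρ ^ 2) * ((8 * Real.pi)⁻¹ * burgersPhi (‖x‖ ^ 2 / 4) * u x ^ 2) +
        (ρ ^ 2)⁻¹ * (‖x‖ ^ 2 * u x ^ 2) := integral_mono iu2 (i1.add i2) fun x => sq_le_two_zone_split u hρ x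
    _ = 2 * Real.pi * (4 + ρ ^ 2) * (∫ x, (8 * Real.pi)⁻¹ * burgersPhi (‖x‖ ^ 2 / 4) * u x ^ 2) +
        (ρ ^ 2)⁻¹ * ∫ x, ‖x‖ ^ 2 * u x ^ 2 := by
        rw [integral_add i1 i2, integral_const_mul, integral_const_mul]
    _ ≤ _ := by
        have h2π : 0 ≤ 2 * Real.pi * (4 + ρ ^ 2) := by positivity
        nlinarith [mul_le_mul_of_nonneg_left hWirt h2π]

end Decay

/-- Registered tools stub of crux stmt-NavierStokesRegularity-17973 (`stub_oddAttenuationToolsG`):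
the lower bound `Ω ≥ (2π(4+|x|²))⁻¹`, Wirtinger on circles for odd functions, `∫ Ω u² ≤ ∫ Ω (∂_θu)²`,
and the two-zone lower bound for `Θ`. [folklore] -/
theorem stub_oddAttenuationToolsG :
    (∀ x : EuclideanSpace ℝ (Fin 2),
      (2 * Real.pi * (4 + ‖x‖ ^ 2))⁻¹ ≤ (8 * Real.pi)⁻¹ * burgersPhi (‖x‖ ^ 2 / 4)) ∧
    (∀ (u : EuclideanSpace ℝ (Fin 2) → ℝ), ContDiff ℝ 1 u → (∀ x, u (-x) = -u x) → ∀ r : ℝ,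
      ∫ θ in (-Real.pi)..Real.pi, u (circlePt r θ) ^ 2 ≤
        ∫ θ in (-Real.pi)..Real.pi, (fderiv ℝ u (circlePt r θ) (perp (circlePt r θ))) ^ 2) ∧
    (∀ (u : EuclideanSpace ℝ (Fin 2) → ℝ), ContDiff ℝ 1 u → (∀ x, u (-x) = -u x) →
      Integrable (fun x => (8 * Real.pi)⁻¹ * burgersPhi (‖x‖ ^ 2 / 4) * fderiv ℝ u x (perp x) ^ 2) →
      Integrable (fun x => (8 * Real.pi)⁻¹ * burgersPhi (‖x‖ ^ 2 / 4) * u x ^ 2) ∧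
        ∫ x, (8 * Real.pi)⁻¹ * burgersPhi (‖x‖ ^ 2 / 4) * u x ^ 2 ≤
          ∫ x, (8 * Real.pi)⁻¹ * burgersPhi (‖x‖ ^ 2 / 4) * fderiv ℝ u x (perp x) ^ 2) ∧
    (∀ (u : EuclideanSpace ℝ (Fin 2) → ℝ), ContDiff ℝ 2 u →
      (∃ (C : ℝ) (N : ℕ), ∀ x, |u x| ≤ C * (1 + ‖x‖) ^ N * Real.exp (-(1 / 8 * ‖x‖ ^ 2)) ∧
        ‖fderiv ℝ u x‖ ≤ C * (1 + ‖x‖) ^ N * Real.exp (-(1 / 8 * ‖x‖ ^ 2)) ∧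
        ‖fderiv ℝ (fderiv ℝ u) x‖ ≤ C * (1 + ‖x‖) ^ N * Real.exp (-(1 / 8 * ‖x‖ ^ 2))) →
      (∀ x, u (-x) = -u x) → ∀ ρ : ℝ, 0 < ρ →
      ∫ x, u x ^ 2 ≤ 2 * Real.pi * (4 + ρ ^ 2) *
          (∫ x, (8 * Real.pi)⁻¹ * burgersPhi (‖x‖ ^ 2 / 4) * fderiv ℝ u x (perp x) ^ 2) +
        (ρ ^ 2)⁻¹ * ∫ x, ‖x‖ ^ 2 * u x ^ 2) :=
  ⟨inv_le_omega, intervalIntegral_sq_circle_le_of_odd, integral_omega_mul_sq_le,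
    fun _ hu hB hodd _ hρ => oddAttenuation_twoZone_estimate hu hB hodd hρ⟩

end Summit.NavierStokesRegularity.NavierStokesRegularity.Theorems
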